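import Summits.HubbardSuperconductivity.HubbardSuperconductivity.Theorems.BalabanIRBirGappedPhaseReductionSpectralTransfer
import HarnessLib

/-!
# Route BalabanIR — crux 4 `BirGappedPhaseReduction` (item `stmt-HubbardSuperconductivity-2082`):
# the ground-state end of the spectral transfer (`M = ∞` versus one Gibbs state)

Companion of `…BirGappedPhaseReductionSpectralTransfer.lean` (finite time extents `M₁ ≤ M`). Here
the transfer is run to `M = ∞`, in Hamiltonian language and with the better constant:

* `groundStateFunctional_re_ge_of_gibbsState` — for a Hermitian `H` on a nonempty index type, an
  observable `0 ≤ O ≤ 1` and `β > 0`,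
  **`1 − (1 − re ⟨O⟩_β) · (re Z(β))²/re Z(2β) ≤ re ⟨O⟩_{ground}`**, where
  `⟨O⟩_{ground} = tr(P₀O)/tr P₀` is the UNIFORM average over the ground eigenspace
  (`Matrix.groundStateFunctional`, the object of the target `BirGroundStateAverageLRO` once
  restricted to a sector), `⟨O⟩_β = tr(e^{-βH}O)/tr e^{-βH}` (`Matrix.gibbsState`) and
  `Z = Matrix.partitionFn`.

So a thermal lower bound at ONE inverse temperature together with ONE free-energy doubling number
`Z(β)²/Z(2β) ≥ 1` bounds the ground-eigenspace average from below — no `β → ∞` limit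
(`tendsto_gibbsState_atTop`, `…SectorGibbsLimit`), no gap hypothesis, no uniformity in `β`.
Proof: in the eigenbasis, `e^{-βH} = U diag(e^{-βλᵢ}) U⋆`, `P₀ = U diag(𝟙[λᵢ = E₀]) U⋆`
(`Matrix.IsHermitian.groundProj_eq_conj_diagonal`), and the real inequality `groundTransfer_core`:
with `w₀ = e^{-βE₀}`, `S = {λᵢ = E₀}`, `s = Σ_S õᵢ`: `Z(2β) ≤ w₀ Z(β)`,
`Z(β) − tr(e^{-βH}O) ≥ w₀(|S| − s)`, `s ≤ |S|`.

No definition is introduced; `Theses`-free. References: H. Tasaki (2020) App. A; Reed–Simon I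
Thm VII.2. [folklore]
-/

noncomputable section

namespace Summit.HubbardSuperconductivity.HubbardSuperconductivity.Theorems

open Matrix Literature.MathematicalPhysics.QuantumLattice
open scoped Matrix.Norms.L2Operator ComplexOrder MatrixOrder InnerProductSpace

variable {n : Type*} [Fintype n] [DecidableEq n]

/-- Core real inequality behind the ground-state transfer: for weights `0 ≤ w ≤ w₀`, `0 < w₀`,
attained exactly on a nonempty finset `S`, and marks `o ∈ [0,1]`,
`1 − (1 − (Σ w o)/(Σ w)) · (Σ w)²/(Σ w²) ≤ (Σ_{S} o)/|S|`. [folklore] -/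
theorem groundTransfer_core {ι : Type*} [Fintype ι] {w o : ι → ℝ} (hw : ∀ i, 0 ≤ w i)
    (ho1 : ∀ i, o i ≤ 1) {w₀ : ℝ} (hw₀ : 0 < w₀) (hmax : ∀ i, w i ≤ w₀)
    (S : Finset ι) (hS : ∀ i ∈ S, w i = w₀) (hSne : S.Nonempty) :
    1 - (1 - (∑ i, w i * o i) / ∑ i, w i) * ((∑ i, w i) ^ 2 / ∑ i, w i ^ 2)
      ≤ (∑ i ∈ S, o i) / S.card := by
  obtain ⟨j, hj⟩ := hSne
  set A := ∑ i, w i with hA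
  set A2 := ∑ i, w i ^ 2 with hA2
  set B := ∑ i, w i * o i with hB
  set s := ∑ i ∈ S, o i with hs
  have hwj : w j = w₀ := hS j hj
  have hApos : 0 < A :=
    lt_of_lt_of_le (hwj ▸ hw₀ : 0 < w j)
      (Finset.single_le_sum (f := w) (fun i _ => hw i) (Finset.mem_univ j))
  have hA2pos : 0 < A2 :=
    lt_of_lt_of_le (by rw [hwj]; positivity : 0 < w j ^ 2)
      (Finset.single_le_sum (f := fun i => w i ^ 2) (fun i _ => sq_nonneg (w i)) (Finset.mem_univ j))
  have hd : (1 : ℝ) ≤ S.card := by exact_mod_cast Finset.card_pos.2 ⟨j, hj⟩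
  have hdpos : (0 : ℝ) < S.card := lt_of_lt_of_le one_pos hd
  -- `A2 ≤ w₀ A`
  have h1 : A2 ≤ w₀ * A := by
    rw [hA, Finset.mul_sum]
    refine Finset.sum_le_sum fun i _ => ?_
    rw [sq]
    exact mul_le_mul_of_nonneg_right (hmax i) (hw i)
  -- `w₀ (|S| - s) ≤ A - B`
  have h2 : w₀ * (S.card - s) ≤ A - B := by
    have hAB : A - B = ∑ i, w i * (1 - o i) := by
      rw [hA, hB, ← Finset.sum_sub_distrib]
      exact Finset.sum_congr rfl fun i _ => by ring
    have hSs : w₀ * (S.card - s) = ∑ i ∈ S, w i * (1 - o i) := by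
      rw [hs, Finset.card_eq_sum_ones, Nat.cast_sum, Nat.cast_one, ← Finset.sum_sub_distrib,
        Finset.mul_sum]
      exact Finset.sum_congr rfl fun i hi => by rw [hS i hi]
    rw [hAB, hSs]
    exact Finset.sum_le_sum_of_subset_of_nonneg (Finset.subset_univ S)
      fun i _ _ => mul_nonneg (hw i) (sub_nonneg.2 (ho1 i))
  -- `s ≤ |S|`
  have h3 : s ≤ S.card := by
    rw [hs, Finset.card_eq_sum_ones, Nat.cast_sum, Nat.cast_one]
    exact Finset.sum_le_sum fun i _ => ho1 i
  -- assemble: `(1 - B/A) · A²/A2 = (A - B) A / A2 ≥ (A - B)/w₀ ≥ |S| - s`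
  have h4 : (S.card : ℝ) - s ≤ (1 - B / A) * (A ^ 2 / A2) := by
    have e1 : (1 - B / A) * (A ^ 2 / A2) = (A - B) * A / A2 := by
      field_simp
    rw [e1, le_div_iff₀ hA2pos]
    calc ((S.card : ℝ) - s) * A2 ≤ ((S.card : ℝ) - s) * (w₀ * A) :=
          mul_le_mul_of_nonneg_left h1 (sub_nonneg.2 h3)
      _ = w₀ * (S.card - s) * A := by ring
      _ ≤ (A - B) * A := mul_le_mul_of_nonneg_right h2 hApos.le
  rw [le_div_iff₀ hdpos]
  nlinarith [h4, h3, hd]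

/-! ### The `M = ∞` end: ground-eigenspace average versus one Gibbs state -/

/-- **Ground-state transfer inequality.** For a Hermitian `H` on a nonempty index type, an
observable `0 ≤ O ≤ 1` and `β > 0`:
`1 − (1 − re ⟨O⟩_β) · (re Z(β))²/re Z(2β) ≤ re ⟨O⟩_{ground}`, where
`⟨O⟩_{ground} = tr(P₀O)/tr P₀` is the uniform average over the ground eigenspace
(`Matrix.groundStateFunctional`), `⟨O⟩_β = tr(e^{-βH}O)/tr e^{-βH}` (`Matrix.gibbsState`) and
`Z = Matrix.partitionFn`. A thermal lower bound at one inverse temperature and the free-energy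
doubling number `Z(β)²/Z(2β) ≥ 1` bound the ground-state average from below. [folklore] -/
theorem groundStateFunctional_re_ge_of_gibbsState [Nonempty n] {H O : Matrix n n ℂ}
    (hH : H.IsHermitian) (hO : O.PosSemidef) (hO1 : (1 - O).PosSemidef) {β : ℝ} (hβ : 0 < β) :
    1 - (1 - (gibbsState β H O).re) *
        ((partitionFn β H).re ^ 2 / (partitionFn (2 * β) H).re)
      ≤ (H.groundStateFunctional O).re := by
  set U : Matrix n n ℂ := (hH.eigenvectorUnitary : Matrix n n ℂ) with hUdef
  have hU : star U * U = 1 := Unitary.coe_star_mul_self hH.eigenvectorUnitary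
  set ev : n → ℝ := hH.eigenvalues with hev
  set o : n → ℝ := fun i => ((star U * O * U) i i).re with ho
  have ho0 : ∀ i, 0 ≤ o i := fun i => re_conj_apply_self_nonneg hO U i
  have ho1 : ∀ i, o i ≤ 1 := fun i => re_conj_apply_self_le_one hO1 hU i
  -- Boltzmann weights in the eigenbasis
  set w : ℝ → n → ℝ := fun b i => Real.exp (-(b * ev i)) with hw
  have hG : ∀ b : ℝ, gibbsWeight b H = U * diagonal (fun i => ((w b i : ℝ) : ℂ)) * star U := by
    intro b
    have hsmul : (-(b : ℂ) • H : Matrix n n ℂ) = (-b : ℝ) • H := by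
      ext i j
      simp [Matrix.smul_apply, Complex.real_smul]
    have h1 : gibbsWeight b H = cfc (fun x : ℝ => Real.exp ((-b) • x)) H := by
      rw [gibbsWeight, hsmul, cfc_comp_smul (-b) Real.exp H, CFC.real_exp_eq_normedSpace_exp]
    rw [h1, hH.cfc_eq, IsHermitian.cfc, Unitary.conjStarAlgAut_apply]
    simp only [smul_eq_mul, neg_mul, hw]
    rfl
  have hZ : ∀ b : ℝ, (partitionFn b H).re = ∑ i, w b i := by
    intro b
    rw [partitionFn, hG b, ← Matrix.mul_one (U * diagonal _ * star U), trace_conj_diagonal_mul,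
      Complex.re_sum]
    refine Finset.sum_congr rfl fun i _ => ?_
    rw [Matrix.mul_one, hU, Matrix.one_apply_eq, mul_one, Complex.ofReal_re]
  have hZO : ∀ b : ℝ, (gibbsWeight b H * O).trace.re = ∑ i, w b i * o i := by
    intro b
    rw [hG b, trace_conj_diagonal_mul, Complex.re_sum]
    refine Finset.sum_congr rfl fun i _ => ?_
    rw [Complex.re_ofReal_mul]
  -- ground energy, the top weight `w₀ = e^{-βE₀}`, the ground set `S`
  set E₀ : ℝ := H.groundEnergy with hE₀
  set S : Finset n := Finset.univ.filter fun i => ev i = E₀ with hS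
  have hEle : ∀ i, E₀ ≤ ev i := fun i => groundEnergy_le_eigenvalues hH i
  obtain ⟨j, hj⟩ : ∃ j, ev j = E₀ := by
    have h : H.groundEnergy = ⨅ i, ev i := groundEnergy_eq_iInf_eigenvalues_holds hH
    -- `E₀ = ⨅ i, ev i` is attained on a finite nonempty type
    obtain ⟨j, hj⟩ := exists_eq_ciInf_of_finite (f := ev)
    exact ⟨j, by rw [hj, ← h]⟩
  have hSne : S.Nonempty := ⟨j, by simp [hS, hj]⟩
  have hSmem : ∀ i, i ∈ S ↔ ev i = E₀ := fun i => by simp [hS]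
  -- the ground projection in the eigenbasis and its traces
  have hP : H.groundProj = U * diagonal (fun i => if ev i = E₀ then (1 : ℂ) else 0) * star U :=
    hH.groundProj_eq_conj_diagonal
  have htrP : H.groundProj.trace = (S.card : ℂ) := by
    rw [hP, ← Matrix.mul_one (U * diagonal _ * star U), trace_conj_diagonal_mul]
    simp only [hU, Matrix.one_apply_eq, mul_one]
    rw [Finset.card_eq_sum_ones, Nat.cast_sum, Nat.cast_one, hS, Finset.sum_filter]
  have htrPO : (H.groundProj * O).trace = ∑ i ∈ S, (star U * O * U) i i := by
    rw [hP, trace_conj_diagonal_mul, hS, Finset.sum_filter]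
    refine Finset.sum_congr rfl fun i _ => ?_
    split_ifs <;> simp
  have hcard : (0 : ℝ) < S.card := by exact_mod_cast Finset.card_pos.2 hSne
  have hgs : (H.groundStateFunctional O).re = (∑ i ∈ S, o i) / S.card := by
    rw [groundStateFunctional_apply, htrP, htrPO, ← Complex.re_sum]
    rw [show ((S.card : ℂ))⁻¹ * (∑ i ∈ S, (star U * O * U) i i) =
      (∑ i ∈ S, (star U * O * U) i i) / (S.card : ℂ) by rw [div_eq_inv_mul]]
    rw [Complex.div_natCast_re]
  -- apply the core inequality with weights `w β`
  have hwpos : 0 < w β j := Real.exp_pos _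
  have hwle : ∀ i, w β i ≤ w β j := by
    intro i
    simp only [hw]
    rw [Real.exp_le_exp, neg_le_neg_iff, hj]
    exact mul_le_mul_of_nonneg_left (hEle i) hβ.le
  have hSw : ∀ i ∈ S, w β i = w β j := by
    intro i hi
    simp only [hw]
    rw [(hSmem i).1 hi, hj]
  have hcore := groundTransfer_core (fun i => (Real.exp_pos _).le) ho1 hwpos hwle S hSw hSne
  have h2β : ∀ i, w (2 * β) i = w β i ^ 2 := by
    intro i
    simp only [hw]
    rw [← Real.exp_nat_mul]
    congr 1
    push_cast
    ring
  have hZc : (gibbsWeight β H).trace = ((∑ i, w β i : ℝ) : ℂ) := by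
    rw [hG β, ← Matrix.mul_one (U * diagonal _ * star U), trace_conj_diagonal_mul]
    push_cast
    refine Finset.sum_congr rfl fun i _ => ?_
    rw [Matrix.mul_one, hU, Matrix.one_apply_eq, mul_one]
  rw [hgs, gibbsState_apply, partitionFn, partitionFn, hZc, ← div_eq_inv_mul,
    Complex.div_ofReal_re, hZO β, Complex.ofReal_re]
  have hZ2 : (gibbsWeight (2 * β) H).trace.re = ∑ i, w β i ^ 2 := by
    rw [show (gibbsWeight (2 * β) H).trace = partitionFn (2 * β) H from rfl, hZ (2 * β)]
    exact Finset.sum_congr rfl fun i _ => h2β i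
  rw [hZ2]
  exact hcore

end Summit.HubbardSuperconductivity.HubbardSuperconductivity.Theorems
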